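/-
COR-CM (cell pub-hodgecm2, stage 2 of the Hodge ladder) — count-neutral KERNEL COMBINATORICS «complemented conjugation ⟺ imaginary quadratic subfield»
(seat prover-pub-hodgecm2-b23-g40-0, binder prover b23, gen 40; claim COMPLEMENT-FACES F9, HOME/INBOX.md l.9766/l.9940; sequel of
`CorCM/FaceComplementGeneration.lean` and `Census/ComplementFacesOddHalf.lean`).  Theorems only; no geometry, no `Universe` field touched, no named fact, nothing asserted; the Galois
correspondence (Mathlib), `galTOfAut` (`CorCM/FaceCensusOddSliceTransport.lean`) and seat b09's complement lemmas are used BY NAME;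
`Interfaces.lean` (C1), every E term, B01 and `Transposition/*` are untouched.
HONEST FRAMING (COORDINATOR RULING — HODGE FRAMING CORRECTION, 2026-08-21T11:55:35Z): `HC_CM` is NOT proved, here or anywhere in the tree;
this file produces no period and proves no face period for any field; its one `HodgeConjectureFor` statement is CONDITIONAL on face periods.
T5: n/a-class — Galois-theoretic dictionary + INT2-GEN's period hypothesis on the produced face set (§2); no named-fact / conjecture-def binder;
checker: self (prover-pub-hodgecm2-b23-g40-0), 2026-08-23.
-/
import Summits.HodgeConjecture.CorCM.FaceComplementGeneration
import Summits.HodgeConjecture.CorCM.Census.ComplementFacesOddHalf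
import HarnessLib

/-!
# Complemented complex conjugation ⟺ an imaginary quadratic subfield; ODD half-degree: exactly `β − 1` faces for EVERY Galois CM field

`CorCM/FaceAbelianImaginaryQuadratic.lean` (this seat, gen 39) proved the dictionary «complex conjugation is a non-square in `Aut(F)` ⟺ `F`
contains an imaginary quadratic field» for COMMUTATIVE `Aut(F)`.  The hypothesis of the COMPLEMENT-FACES lane is the commutativity-free notion:
`conjT` is COMPLEMENTED in `GalT F` (a subgroup `A` with `P ∈ A ↔ conjT·P ∉ A`, i.e. an index-two subgroup missing `conjT`).  Here:

* `exists_quadratic_subfield_moved_of_index_two`: an index-two subgroup of `Aut(F)` missing `c` gives, by the Galois correspondence, a quadratic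
  subfield (its fixed field) with an element moved by `c` (`F/ℚ` Galois; any group);
* **`exists_imaginary_quadratic_subfield_of_cpl`**: a complement of `conjT` in `GalT F` (read back through `galTOfAut σ₀`) gives a subfield of
  degree `2` with an element of non-real image under `σ₀`;
* **`exists_cpl_iff_exists_imaginary_quadratic_subfield`** (with part F6's converse `exists_cpl_of_imaginary_quadratic_subfield`): for EVERY Galois
  CM field `F` and base embedding `σ₀`, `conjT` is complemented in `GalT F` iff `F` contains an imaginary quadratic field — so the face counts of
  `CorCM/FaceComplementGeneration.lean` (exactly `β(F) − 1 − δ(F)` generating faces) apply to precisely these fields, `Gal(F⁺/ℚ)` arbitrary.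
* §2 **ODD HALF-DEGREE — NO HYPOTHESIS AT ALL.**  If `[F:ℚ]/2` is odd, complex conjugation is ALWAYS complemented (the sign of the regular
  representation, `Census.ComplementFaces.exists_cpl_of_odd_half`); hence EVERY Galois CM field of degree `≡ 2 (mod 4)` contains an imaginary
  quadratic field (`exists_imaginary_quadratic_subfield_of_odd`) and has EXACTLY `β(F) − 1` generating rank-four faces, none fewer
  (**`isLeast_card_faces_hgen_of_odd`** — the existence half of seat b09's `FaceCoinvariantOddHalf`, attained by faces, for every Galois group of
  twice odd order), with the conditional HC reading `hodgeConjectureFor_of_odd_of_exists_facePeriod`.  `HC_CM` is NOT proved.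

References: [cite: Shimura1998, §8.1 (p. 62), §6.2 Theorem 3]; [cite: Pohlmann1968, Thm. 1]; [cite: Milne1999LefschetzClasses, Thm. 3.2, Prop. 2.1];
[cite: MumfordAV1970, §19 Thm. 1 and p. 169].
-/

noncomputable section

open CategoryTheory NumberField NumberField.ComplexEmbedding
open Literature.AlgebraicGeometry Literature.AlgebraicGeometry.Motives Literature.AlgebraicGeometry.HodgeTheory
open Literature.AlgebraicGeometry.ComplexMultiplication Literature.AlgebraicGeometry.Milne1999
open Literature.NumberTheory.Automorphic
open Literature.NumberTheory.Automorphic.PicardCM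
open Summit.HodgeConjecture.CorCM.Domination

namespace Summit.HodgeConjecture.CorCM.FaceComplement

open Summit.HodgeConjecture.CorCM.Prior.AllgGroup.RfwfAllgGroup
open Summit.HodgeConjecture.CorCM.Census.BlockParity
open Summit.HodgeConjecture.CorCM.Census.Coinvariant
open Summit.HodgeConjecture.CorCM.FaceCensus.OddSlice (galTOfAut galTOfAut_mul galTOfAut_conjAut)

/-! ## §1 The dictionary -/

section Field

variable {F : Type} [Field F] [NumberField F]

/-- **An index-two subgroup of `Aut(F)` missing `c` gives a quadratic subfield moved by `c`**: its fixed field has degree `2` over `ℚ` and `c`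
moves some of its elements (`F/ℚ` Galois; no commutativity). [folklore] -/
theorem exists_quadratic_subfield_moved_of_index_two [IsGalois ℚ F] {H : Subgroup (F ≃ₐ[ℚ] F)} (hidx : H.index = 2)
    {c : F ≃ₐ[ℚ] F} (hcH : c ∉ H) : ∃ E : IntermediateField ℚ F, Module.finrank ℚ E = 2 ∧ ∃ x ∈ E, c x ≠ x := by
  refine ⟨IntermediateField.fixedField H, ?_, ?_⟩
  · -- degree: `[F : fixedField H] = |H|` and `index · |H| = |Aut F| = [F : ℚ]`
    have h1 := IntermediateField.finrank_fixedField_eq_card H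
    have h2 : H.index * Nat.card H = Nat.card (F ≃ₐ[ℚ] F) := H.index_mul_card
    rw [hidx, IsGalois.card_aut_eq_finrank, ← Module.finrank_mul_finrank ℚ (IntermediateField.fixedField H) F, h1] at h2
    have hpos : 0 < Nat.card H := Nat.card_pos
    exact (Nat.eq_of_mul_eq_mul_right hpos h2).symm
  · by_contra h
    apply hcH
    rw [← IntermediateField.fixingSubgroup_fixedField H]
    refine (IntermediateField.mem_fixingSubgroup_iff _ c).mpr fun x hx => ?_
    by_contra hne
    exact h ⟨x, hx, hne⟩

/-- **A complement of complex conjugation gives an imaginary quadratic subfield** (`F` Galois CM, no commutativity): if `conjT` is complemented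
in `GalT F` then `F` has a subfield of degree `2` over `ℚ` with an element of non-real image under `σ₀`. [cite: Shimura1998, §8.1 (p. 62)] -/
theorem exists_imaginary_quadratic_subfield_of_cpl [IsCMField F] [IsGalois ℚ F] (σ₀ : F →+* ℂ) {A : Subgroup (GalT F)}
    (hA : ∀ P : GalT F, P ∈ A ↔ conjT * P ∉ A) :
    ∃ E : IntermediateField ℚ F, Module.finrank ℚ E = 2 ∧ ∃ x ∈ E, (σ₀ x).im ≠ 0 := by
  obtain ⟨c, hc⟩ := FaceCensus.exists_conjAut σ₀
  set e : (F ≃ₐ[ℚ] F) ≃* GalT F := MulEquiv.mk' (galTOfAut σ₀) (galTOfAut_mul σ₀) with he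
  have hec : e c = conjT := by rw [he]; exact galTOfAut_conjAut σ₀ hc
  have hidx : (A.comap (e : (F ≃ₐ[ℚ] F) →* GalT F)).index = 2 := by
    rw [Subgroup.index_comap_of_surjective _ (by exact e.surjective)]
    exact index_eq_two_of_cpl conjT (fun P => FaceBasis.conjT_comm P) hA
  have hcH : c ∉ A.comap (e : (F ≃ₐ[ℚ] F) →* GalT F) := by
    rw [Subgroup.mem_comap]
    change e c ∉ A
    rw [hec]
    exact self_notMem_cpl conjT conjT_mul_self hA
  obtain ⟨E, hE, x, hxE, hx⟩ := exists_quadratic_subfield_moved_of_index_two hidx hcH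
  refine ⟨E, hE, x, hxE, fun him => hx ?_⟩
  apply σ₀.injective
  have h1 : σ₀ (c x) = starRingEnd ℂ (σ₀ x) := by
    have := RingHom.congr_fun hc x
    simpa [conjugate_coe_eq] using this
  rw [h1]
  exact Complex.conj_eq_iff_im.mpr him

/-- **THE DICTIONARY (any Galois CM field, no commutativity).**  Complex conjugation is complemented in `GalT F` iff `F` contains an imaginary
quadratic field (a subfield of degree `2` with a non-real element under `σ₀`). [cite: Shimura1998, §8.1 (p. 62)] -/
theorem exists_cpl_iff_exists_imaginary_quadratic_subfield [IsCMField F] [IsGalois ℚ F] (σ₀ : F →+* ℂ) :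
    (∃ A : Subgroup (GalT F), ∀ P : GalT F, P ∈ A ↔ conjT * P ∉ A) ↔
      ∃ E : IntermediateField ℚ F, Module.finrank ℚ E = 2 ∧ ∃ x ∈ E, (σ₀ x).im ≠ 0 :=
  ⟨fun ⟨_, hA⟩ => exists_imaginary_quadratic_subfield_of_cpl σ₀ hA,
    fun ⟨E, hE, hx⟩ => exists_cpl_of_imaginary_quadratic_subfield σ₀ E hE hx⟩

/-- **Index-two form of the dictionary**: an index-two subgroup of `GalT F` missing `conjT` exists iff `F` contains an imaginary quadratic field.
[cite: Shimura1998, §8.1 (p. 62)] -/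
theorem exists_index_two_iff_exists_imaginary_quadratic_subfield [IsCMField F] [IsGalois ℚ F] (σ₀ : F →+* ℂ) :
    (∃ A : Subgroup (GalT F), A.index = 2 ∧ conjT ∉ A) ↔
      ∃ E : IntermediateField ℚ F, Module.finrank ℚ E = 2 ∧ ∃ x ∈ E, (σ₀ x).im ≠ 0 := by
  rw [← exists_cpl_iff_exists_imaginary_quadratic_subfield σ₀]
  constructor
  · rintro ⟨A, h2, hc⟩
    exact ⟨A, FaceCoinvariant.cpl_of_index_two h2 hc⟩
  · rintro ⟨A, hA⟩
    exact ⟨A, index_eq_two_of_cpl conjT (fun P => FaceBasis.conjT_comm P) hA, self_notMem_cpl conjT conjT_mul_self hA⟩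


/-! ## §2 Odd half-degree: the complement always exists -/

/-- **`[F:ℚ]/2` odd ⟹ complex conjugation is complemented in `GalT F`** (every Galois CM field of degree `≡ 2 (mod 4)`; the kernel of the sign
of the regular representation). [folklore] -/
theorem exists_cpl_of_odd [IsCMField F] [IsGalois ℚ F] (hodd : Odd (Module.finrank ℚ F / 2)) :
    ∃ A : Subgroup (GalT F), ∀ P : GalT F, P ∈ A ↔ conjT * P ∉ A :=
  Census.ComplementFaces.exists_cpl_of_odd_half (conjT : GalT F) conjT_mul_self conjT_ne_one (by rw [FaceCensus.card_galT]; exact hodd)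

/-- **Every Galois CM field of degree `≡ 2 (mod 4)` contains an imaginary quadratic field.** [cite: Shimura1998, §8.1 (p. 62)] -/
theorem exists_imaginary_quadratic_subfield_of_odd [IsCMField F] [IsGalois ℚ F] (σ₀ : F →+* ℂ) (hodd : Odd (Module.finrank ℚ F / 2)) :
    ∃ E : IntermediateField ℚ F, Module.finrank ℚ E = 2 ∧ ∃ x ∈ E, (σ₀ x).im ≠ 0 := by
  obtain ⟨A, hA⟩ := exists_cpl_of_odd (F := F) hodd
  exact exists_imaginary_quadratic_subfield_of_cpl σ₀ hA

/-- **ODD HALF-DEGREE: EXACTLY `β(F) − 1` GENERATING FACES FOR EVERY GALOIS CM FIELD** — `[F:ℚ]/2` odd, `F/ℚ` Galois CM, any Galois group,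
no other hypothesis: the least size of a face set `𝒮` with `hgen(𝒮, σ₀)` is `#Block conjT − 1` (`= φ₂(F)`, seat b09's `FaceCoinvariantOddHalf`).
[cite: Pohlmann1968, Thm. 1] [cite: Milne1999LefschetzClasses, Thm. 3.2, Prop. 2.1] -/
theorem isLeast_card_faces_hgen_of_odd [IsCMField F] [IsGalois ℚ F] (hodd : Odd (Module.finrank ℚ F / 2)) (σ₀ : F →+* ℂ) :
    IsLeast {m : ℕ | ∃ 𝒮 : Finset (Face F), 𝒮.card = m ∧
      ∀ f : Face F, lefChar f.corner (fun _ => ({σ₀} : Finset (F →+* ℂ))) ∈ AddSubgroup.closure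
        {a : Asym F | ∃ g ∈ (𝒮 : Set (Face F)), ∃ σ : F →+* ℂ, a = lefChar g.corner (fun _ => ({σ} : Finset (F →+* ℂ)))}}
      (Fintype.card (Block (conjT : GalT F)) - 1) := by
  obtain ⟨A, hA⟩ := exists_cpl_of_odd (F := F) hodd
  exact isLeast_card_faces_hgen_of_cpl_odd hA hodd σ₀

end Field

/-! ## §3 The Hodge-conjecture reading for odd half-degree (conditional on the face periods) -/

/-- **HC for the slice of ANY Galois CM field of degree `≡ 2 (mod 4)`, `≥ 6`, from `β − 1` face periods** (INT2-GEN socket BY NAME; CONDITIONAL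
on the periods — `HC_CM` is NOT proved; no hypothesis on the Galois group): there is a face set `𝒮` with `|𝒮| + 1 = β(K)` such that ONE period
witness per face of `𝒮` on the universe of record implies the Hodge conjecture for every abelian variety dominated by a product of CM abelian
varieties with CM by subfields of `K`.
[cite: Shimura1998, §6.2 Theorem 3 and §6.1 Corollary of Theorem 2 (pp. 41–43)] [cite: Pohlmann1968, Thm. 1]
[cite: Milne1999LefschetzClasses, Thm. 3.2 and Cor. 4.5] [cite: MumfordAV1970, §19 Thm. 1 and p. 169] -/
theorem hodgeConjectureFor_of_odd_of_exists_facePeriod (K : CMField) [hGal : IsGalois ℚ K] (hodd : Odd (Module.finrank ℚ K / 2))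
    (h6 : 6 ≤ Module.finrank ℚ K) (σ₀ : (K : Type) →+* ℂ) :
    ∃ 𝒮 : Finset (Face K), 𝒮.card + 1 = Fintype.card (Block (conjT : GalT K)) ∧
      ((∀ f ∈ 𝒮, ∃ ι₁ : K →+* ℂ, f.Admissible ι₁ ∧ ∃ (V : HermSpace3 K ι₁) (σ : K →+* ℂ),
        (Model.picardCMUniverse exists_isReal_hodgeModel_holds hodgePQ_independent_of_hodgeModel_holds
          BallQuotient.ballQuotientUniformised_holds cmAbelianVarietyRealised_holds).PeriodNV ι₁ V K f.psi σ) →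
      ∀ {P B : AbelianVariety ℂ}, AbelianVariety.IsProductOf (fun B : AbelianVariety ℂ =>
        ∃ (E : Type) (_ : Field E) (_ : NumberField E) (_ : IsCMField E) (_ : E →+* (K : Type)) (Φ : CMType E)
          (ι : 𝓞 E →+* End B) (θ : E →+* Module.End ℂ (complexBetti B.X 1)),
          IsCMTypeRealisation Φ B ι θ) P →
      AVDominatedBy B P → HodgeConjectureFor B.dim B.X) := by
  obtain ⟨A, hA⟩ := exists_cpl_of_odd (F := K) hodd
  obtain ⟨𝒮, hcard, hgen⟩ := exists_faces_hgen_of_cpl (F := K) hA (cplT conjT A hA) σ₀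
  have h1 := FaceCoinvariant.fibreTwo_add_one_add_wdelta_eq_card_block_of_cpl hA (cplT conjT A hA)
  have h2 := FaceCoinvariant.fibreTwo_add_one_eq_card_block_of_odd_finrank_div_two (F := K) hodd
  refine ⟨𝒮, by omega, fun h P B hP hB => ?_⟩
  exact hodgeConjectureFor_of_avDominatedBy_isProductOf_of_exists_facePeriod_on K h6 (𝒮 : Set (Face K)) σ₀ hgen
    (fun f hf => h f (Finset.mem_coe.mp hf)) hP hB

end Summit.HodgeConjecture.CorCM.FaceComplement

end
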